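import Summits.CriticalPhenomena.PercolationContinuityZ3.Theorems.PercNearOneGluingNoHeavyQuantSDEC
import HarnessLib

/-!
# QUANT lane R8 on trees: Theorem A (two-layer closure at `q = 1`, `y ≥ 1/2`) — part 2b, the COLUMN PROFILE `need` of the certificate S*
# (generic "two-level upper envelope" of a U-predicate and a W-predicate) and its properties (N0), (N1), (NU), (NW), (Nmono), (Npos), (Nvanish)

builds on p205010 (kernel theorem, internal audit signed; external expert review pending)

Support file (`--supports stmt-CriticalPhenomena-4575`), QUANT lane seat prim-quant-arm-2 (gen 38), rung R8 of
`run/shared/lean/prim/quant/LADDER.md`; memo `run/shared/lean/prim/quant/prim-quant-arm-2-g38/TWO-LAYER-CLOSURE-G38.md` §7, §11.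
Theorems only, standard axioms, no sorries.

THE PROFILE.  For predicates `U W : ℕ → ℕ → Prop` on cells (in S*: U = uncovered low cell, W = window cell), a level `r ∈ [0,1]` (in S*: `r = (1−y)/y = 1/u`)
and a row bound `K` (all U/W-cells have row `≤ K`; in S*: `K = k`), the profile of column `a` at row `s` is
`need a s = 1` if some U-cell `(a, s′)` has `s ≤ s′ ≤ K`, else `r` if some W-cell has, else `0` — the least nonincreasing majorant of
`1_U + r·1_W` along the column.  Its layer cake `need a c − need a (c+1) ≥ 0` is the family of factor 2's reflection weights of column `a` (memo §7);
`halfCert_pointwise` (`…QuantTwoLayerHalfPointwise`) consumes exactly the properties proved here.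

* `LawDec.need_nonneg`, `need_le_one`, `need_eq_one_of_U`, `need_ge_of_W`, `need_antitone`, `need_pos_witness`, `need_eq_zero_of_lt`.

[this work].  Nothing here is cited as a published result.  The gluing rows served [cite: KozmaNitzan2024, Conjecture 3 (p. 15)]; product measure
[cite: Grimmett1999, §1.3 p. 10].
-/

noncomputable section

open scoped Classical

namespace Summit.CriticalPhenomena.PercolationContinuityZ3.Theorems

namespace Quant

open Finset

namespace LawDec

/-- (N0) the profile is nonnegative (`0 ≤ r`). [this work] -/
theorem need_nonneg (U W : ℕ → ℕ → Prop) (r : ℝ) (K a s : ℕ) (hr0 : 0 ≤ r) :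
    0 ≤ (if ∃ s' ∈ Finset.Icc s K, U a s' then (1 : ℝ) else if ∃ s' ∈ Finset.Icc s K, W a s' then r else 0) := by
  split_ifs <;> first | exact zero_le_one | exact hr0 | exact le_rfl

/-- (N1) the profile is at most `1` (`r ≤ 1`). [this work] -/
theorem need_le_one (U W : ℕ → ℕ → Prop) (r : ℝ) (K a s : ℕ) (hr1 : r ≤ 1) :
    (if ∃ s' ∈ Finset.Icc s K, U a s' then (1 : ℝ) else if ∃ s' ∈ Finset.Icc s K, W a s' then r else 0) ≤ 1 := by
  split_ifs <;> first | exact le_rfl | exact hr1 | exact zero_le_one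

/-- (NU) at a U-cell of row `s ≤ K` the profile is `1`. [this work] -/
theorem need_eq_one_of_U (U W : ℕ → ℕ → Prop) (r : ℝ) (K a s : ℕ) (hs : s ≤ K) (hU : U a s) :
    (if ∃ s' ∈ Finset.Icc s K, U a s' then (1 : ℝ) else if ∃ s' ∈ Finset.Icc s K, W a s' then r else 0) = 1 := by
  rw [if_pos ⟨s, Finset.mem_Icc.2 ⟨le_rfl, hs⟩, hU⟩]

/-- (NW) at a W-cell of row `s ≤ K` the profile is `≥ r` (`r ≤ 1`). [this work] -/
theorem need_ge_of_W (U W : ℕ → ℕ → Prop) (r : ℝ) (K a s : ℕ) (hr1 : r ≤ 1) (hs : s ≤ K) (hW : W a s) :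
    r ≤ (if ∃ s' ∈ Finset.Icc s K, U a s' then (1 : ℝ) else if ∃ s' ∈ Finset.Icc s K, W a s' then r else 0) := by
  split_ifs with h1 h2
  · exact hr1
  · exact le_rfl
  · exact (h2 ⟨s, Finset.mem_Icc.2 ⟨le_rfl, hs⟩, hW⟩).elim

/-- (Nmono) the profile is nonincreasing along the column (`0 ≤ r ≤ 1`). [this work] -/
theorem need_antitone (U W : ℕ → ℕ → Prop) (r : ℝ) (K a s s₂ : ℕ) (hr0 : 0 ≤ r) (hr1 : r ≤ 1) (hss : s ≤ s₂) :
    (if ∃ s' ∈ Finset.Icc s₂ K, U a s' then (1 : ℝ) else if ∃ s' ∈ Finset.Icc s₂ K, W a s' then r else 0)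
      ≤ (if ∃ s' ∈ Finset.Icc s K, U a s' then (1 : ℝ) else if ∃ s' ∈ Finset.Icc s K, W a s' then r else 0) := by
  have hsub : ∀ s', s' ∈ Finset.Icc s₂ K → s' ∈ Finset.Icc s K := by
    intro s' hs'
    rw [Finset.mem_Icc] at hs' ⊢
    exact ⟨le_trans hss hs'.1, hs'.2⟩
  by_cases hU2 : ∃ s' ∈ Finset.Icc s₂ K, U a s'
  · obtain ⟨s', hs', hU⟩ := hU2
    rw [if_pos ⟨s', hs', hU⟩, if_pos ⟨s', hsub s' hs', hU⟩]
  · rw [if_neg hU2]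
    by_cases hW2 : ∃ s' ∈ Finset.Icc s₂ K, W a s'
    · obtain ⟨s', hs', hW⟩ := hW2
      rw [if_pos ⟨s', hs', hW⟩]
      split_ifs with h1 h2
      · exact hr1
      · exact le_rfl
      · exact (h2 ⟨s', hsub s' hs', hW⟩).elim
    · rw [if_neg hW2]
      exact need_nonneg U W r K a s hr0

/-- (Npos) where the profile is positive there is a U- or W-cell at or above. [this work] -/
theorem need_pos_witness (U W : ℕ → ℕ → Prop) (r : ℝ) (K a s : ℕ)
    (hpos : 0 < (if ∃ s' ∈ Finset.Icc s K, U a s' then (1 : ℝ) else if ∃ s' ∈ Finset.Icc s K, W a s' then r else 0)) :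
    ∃ s'', s ≤ s'' ∧ (U a s'' ∨ W a s'') := by
  by_cases hU : ∃ s' ∈ Finset.Icc s K, U a s'
  · obtain ⟨s', hs', h⟩ := hU
    exact ⟨s', (Finset.mem_Icc.1 hs').1, Or.inl h⟩
  · rw [if_neg hU] at hpos
    by_cases hW : ∃ s' ∈ Finset.Icc s K, W a s'
    · obtain ⟨s', hs', h⟩ := hW
      exact ⟨s', (Finset.mem_Icc.1 hs').1, Or.inr h⟩
    · rw [if_neg hW] at hpos
      exact (lt_irrefl _ hpos).elim

/-- (Nvanish) the profile vanishes above the row bound `K`. [this work] -/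
theorem need_eq_zero_of_lt (U W : ℕ → ℕ → Prop) (r : ℝ) (K a s : ℕ) (hs : K < s) :
    (if ∃ s' ∈ Finset.Icc s K, U a s' then (1 : ℝ) else if ∃ s' ∈ Finset.Icc s K, W a s' then r else 0) = 0 := by
  have hempty : ∀ (P : ℕ → Prop), ¬ ∃ s' ∈ Finset.Icc s K, P s' := by
    intro P ⟨s', hs', _⟩
    rw [Finset.mem_Icc] at hs'
    omega
  rw [if_neg (hempty (U a)), if_neg (hempty (W a))]

/-- **layer-cake / telescoping**: for a profile vanishing above `K` and `m ≤ K + 1`, `Σ_{c = m}^{K} (need c − need (c+1)) = need m`. [this work] -/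
theorem sum_Icc_sub_succ_telescope (f : ℕ → ℝ) (K m : ℕ) (hm : m ≤ K + 1) (hK : f (K + 1) = 0) :
    ∑ c ∈ Finset.Icc m K, (f c - f (c + 1)) = f m := by
  -- `Icc m K = Ico m (K+1)`
  have hIcc : Finset.Icc m K = Finset.Ico m (K + 1) := by
    ext c; simp only [Finset.mem_Icc, Finset.mem_Ico]; omega
  rw [hIcc, Finset.sum_Ico_eq_sum_range]
  have htel : ∀ n : ℕ, ∑ c ∈ Finset.range n, (f (m + c) - f (m + c + 1)) = f m - f (m + n) := by
    intro n
    induction n with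
    | zero => simp
    | succ n ih =>
      rw [Finset.sum_range_succ, ih]
      have : m + (n + 1) = m + n + 1 := by ring
      rw [this]; ring
  rw [htel (K + 1 - m)]
  have : m + (K + 1 - m) = K + 1 := by omega
  rw [this, hK, sub_zero]

end LawDec

end Quant

end Summit.CriticalPhenomena.PercolationContinuityZ3.Theorems
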